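import Literature.AnabelianGeometry.SemiGraphs.ArithNotEdgeLikeOfVerticialOuterAction
import Literature.AnabelianGeometry.SemiGraphs.ArithThm54CapstonesCharCores
import Literature.AnabelianGeometry.SemiGraphs.ArithMaximalCompactClosures
import Literature.AnabelianGeometry.SemiGraphs.ArithNotAmpleBot
import Literature.AnabelianGeometry.SemiGraphs.ArithmeticDef51CondAClosures
import Literature.AnabelianGeometry.SemiGraphs.ArithmeticDef51CondBClosures
import Literature.AnabelianGeometry.AbsoluteAnabelian.MLFGaloisTFGProofs
import HarnessLib

/-!
# [SemiAnbd] §5 — L-F pack B instance forms at the genuine carriers (Rmk 5.3.1, Def 5.3 (i), Def 5.1 (i))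

Mochizuki, *Semi-graphs of anabelioids*, Publ. RIMS **42** (2006), §5: Def 5.1 (i)(a)–(d) p. 62,
Def 5.3 (i) p. 65, Rmk 5.3.1 p. 65 ("the intersection with `Π^temp_𝔾` of a verticial (resp. edge-like)
subgroup of `Π^temp_𝔊` is a verticial (resp. edge-like) subgroup of `Π^temp_𝔾` in the sense of Theorem 3.7"),
Thm 5.4 p. 66, Ex 5.6 p. 67 (the arithmetic component of the semi-graph of anabelioids of a pointed stable
curve over an MLF `K` is `G_K`). [cite: MochizukiSemiAnbd2006, Rmk 5.3.1, p. 65]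

PROOF-ONLY closer (cell abc-iut, D-0079 L-F sub-cell [SemiAnbd]+[CombGC], pack B = §5; abc-iut-L3-lead (gen 6)
β2 table `plan/L3/LF-SGA.tsv`; seat abc-iut-w4-d059 gen 5; rows F-1400 · F-1401 · F-1406 · F-0263 · F-1411 ·
F-2513).  No definition, no new named fact, nothing restated: every theorem is an INSTANCE FORM of a typed §5
predicate at a genuine carrier, knit BY NAME from landed theorems.  The FACT rows are assumption LABELS on OUR
typed statements: their universal closures are refuted in the tree as typed (`not_forall_…`,
`ArithMaximalCompactClosures` / `ArithmeticDef51Cond{A,B,C}Closures`); the instance forms below are the content.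

* **F-1400 (Rmk 5.3.1, second sentence) — THM-INSTANCE, hypothesis-free at FINITE graphs.**  For a finite graph
  of anabelioids `𝒢` satisfying the hypotheses of Thm 3.7, ANY tempered chart `c`, ANY outer action
  `ρ : Π_A → Out_top(π₁^temp 𝒢)` and ANY compatible representatives `R`, the typed second sentence of Rmk 5.3.1
  holds for the produced decomposition data `decompositionDataOfChart R ι` at the outer model
  `Π^temp_𝔊 := π₁^temp(𝒢) ⋊^out Π_A` (abc-iut-w4-d029's capstone currency), the geometric predicates being
  "image under `ι` of a §3 verticial (resp. edge-like) subgroup": abc-iut-w5-d215's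
  `intersectionWithGeometricStatement_outerAction_of_at` (from Thm 3.7 (iii) at `𝒢`, binder
  `CompactInVerticialAt 𝒢`) with that binder DISCHARGED by abc-iut-L3-t8's `compactInVerticialAt_of_finiteGraph`
  ([SemiAnbd] Thm 3.7 (iii) is a theorem at every finite graph, p431007).  Also the finite-BRANCH form (the
  instance binders of the Thm 5.4 capstones) and the form AT THE CARRIER OF THE THEOREM OF RECORD — the chart of
  the CHARACTERISTIC Galois tower (`GaloisLevelData.ofCharCores`, T54 capstone v8 p449794) — at an arbitrary `Rc'`.
  (At a general countable graph the binder `CompactInVerticialAt 𝒢` is NOT dischargeable: it fails at the theta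
  ray `𝒢_θ`, abc-iut-L3-d4 `thetaRayFreeProP_exists_compact_forall_not_le_verticial`, p448544.)
* **F-1401 (Def 5.3 (i) `IsArithAmple`) — PRED-NV at the genuine outer model**, both ways: the whole group
  `π₁^temp(𝒢) ⋊^out Π_A` is arithmetically ample (`aug` is onto, `outerSemidirectProductSnd_surjective`) and the
  trivial subgroup is NOT, for `Π_A` compact and infinite (abc-iut-w4-d098 `not_isArithAmple_bot_of_compactSpace`)
  — so the predicate is a genuine condition at print's data, neither vacuous nor a tautology.
* **F-0263 (Def 5.1 (i)(a) `Def51CondA`) — PRED-NV at the genuine arithmetic component `π̂₁(A) = G_K`**, `K` a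
  non-archimedean local field of characteristic `0` (Ex 5.6), resp. `K/ℚ_p` finite: `G_K` is topologically
  finitely generated, modulo Tate's local Euler–Poincaré characteristic BY NAME (the tree's named fact
  `localEulerPoincareCharacteristic`, proved Summits-side; abc-iut-L4-d1's
  `isTopologicallyFinitelyGenerated_absoluteGaloisGroup(_padic)_of_localEPC`, [NSW] 7.5.10); both ways with
  abc-iut-L4's `not_isTopologicallyFinitelyGenerated_absoluteGaloisGroup` (`G_F`, `F` a number field, is not).
* **F-1411 / F-2513 (Def 5.1 (i)(b) `Def51CondB`, (i)(c) `Def51CondC`) — PRED-NV at the genuine carrier "every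
  connected arithmetic semi-graph of anabelioids" (Def 5.1 (ii), structure `ArithSemiGraph`)**: conditions
  (a)–(d) hold for some open `H ⊆ π̂₁(A)` by the continuity field of the structure (`ArithSemiGraph.def51CondB`
  is abc-iut-f-157's; (a), (c), (d) and the joint form are added here).
* **F-1406 (Def 5.3 (ii) `IsTotallyArithEstranged`)** is NOT re-proved here: its NV record is in the tree —
  INHABITED at a non-split abstract design with an edge (abc-iut-w6-d064 `exists_isTotallyArithEstranged_affine`,
  p440884), vacuous at edgeless produced data (`isTotallyArithEstranged_decompositionDataOfChart_of_isEmpty`),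
  REFUTED for split / open-kernel / finite-index-kernel actions (`not_isTotallyArithEstranged_of_trivial`,
  `…_of_isOpen_ker`, `…_of_finiteIndex_ker`) and at the Iwahori cusp charts
  (`not_isTotallyArithEstranged_cuspChart`, p444375/p444753); it is Thm 5.4's OWN hypothesis `hest`, read at
  print's own decomposition data in the theorem of record (v8).

Honest framing: «PROVED» = OUR kernel check of OUR typed instance form; typed ≠ proved for anything not
stated; nothing here bears on, asserts or refutes [IUTchIII] Cor. 3.12 or abc.
-/

noncomputable section

namespace Literature.AnabelianGeometry.SemiGraphs

open _root_.CategoryTheory Topology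
open Literature.AnabelianGeometry.EtaleTheta
open Literature.AnabelianGeometry.AbsoluteAnabelian

universe u u' v w

/-! ### F-1400 — Rmk 5.3.1, second sentence, at the outer model, hypothesis-free at finite graphs -/

namespace ProfiniteSemiGraph

section OuterModel

variable {𝒢 : ProfiniteSemiGraph.{u}} (c : TemperedPiChart 𝒢) {PA : Type w} [Group PA]
  (ρ : PA →* TopOut c.G)

/-- **F-1400 · [SemiAnbd] Rmk 5.3.1, second sentence, AT THE OUTER MODEL `π₁^temp(𝒢) ⋊^out Π_A`,
HYPOTHESIS-FREE AT FINITE GRAPHS.**  For a finite graph of anabelioids `𝒢` satisfying the hypotheses of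
Thm 3.7, any tempered chart `c`, any outer action `ρ` of `Π_A` and any compatible representatives `R`: "the
intersection with `Π^temp_𝔾 = Ker(Π^temp_𝔊 ↠ Π_A)` of a verticial (resp. edge-like) subgroup of `Π^temp_𝔊` is
a verticial (resp. edge-like) subgroup of `Π^temp_𝔾` in the sense of Theorem 3.7" holds for the produced
decomposition data — Thm 3.7 (iii) at `𝒢` being a THEOREM at finite graphs
(`compactInVerticialAt_of_finiteGraph`). [cite: MochizukiSemiAnbd2006, Rmk 5.3.1, p. 65] -/
theorem intersectionWithGeometricStatement_outerAction_of_finiteGraph [Finite 𝒢.graph.Vertex]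
    [Finite 𝒢.graph.Edge] (h37 : 𝒢.Thm37Hypotheses) (hG : 𝒢.graph.IsGraph) (R : ChartRepresentatives c) :
    IntersectionWithGeometricStatement (decompositionDataOfChart R (toOuterSemidirectProduct ρ))
      (outerSemidirectProductSnd ρ)
      (fun K => ∃ w : 𝒢.graph.Vertex, ∃ H ∈ verticialSubgroups c w,
        K = H.map (toOuterSemidirectProduct ρ))
      (fun K => ∃ e : 𝒢.graph.Edge, ∃ L ∈ edgeLikeSubgroups c e,
        K = L.map (toOuterSemidirectProduct ρ)) :=
  intersectionWithGeometricStatement_outerAction_of_at c ρ compactInVerticialAt_of_finiteGraph h37 hG R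

/-- **F-1400 at the outer model, finite-BRANCH form** (the instance binders `[Finite 𝒢.graph.Vertex]`
`[Finite 𝒢.graph.Branch]` of the Thm 5.4 capstones; finitely many branches give finitely many edges,
`SemiGraph.two_branches`). [cite: MochizukiSemiAnbd2006, Rmk 5.3.1, p. 65] -/
theorem intersectionWithGeometricStatement_outerAction_of_finiteBranch [Finite 𝒢.graph.Vertex]
    [Finite 𝒢.graph.Branch] (h37 : 𝒢.Thm37Hypotheses) (hG : 𝒢.graph.IsGraph) (R : ChartRepresentatives c) :
    IntersectionWithGeometricStatement (decompositionDataOfChart R (toOuterSemidirectProduct ρ))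
      (outerSemidirectProductSnd ρ)
      (fun K => ∃ w : 𝒢.graph.Vertex, ∃ H ∈ verticialSubgroups c w,
        K = H.map (toOuterSemidirectProduct ρ))
      (fun K => ∃ e : 𝒢.graph.Edge, ∃ L ∈ edgeLikeSubgroups c e,
        K = L.map (toOuterSemidirectProduct ρ)) :=
  haveI : Finite 𝒢.graph.Edge := Finite.of_surjective 𝒢.graph.edgeOf fun e => by
    obtain ⟨b₁, -, -, h₁, -⟩ := 𝒢.graph.two_branches e
    exact ⟨b₁, h₁⟩
  intersectionWithGeometricStatement_outerAction_of_finiteGraph c ρ h37 hG R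

/-! ### F-1401 — Def 5.3 (i) `IsArithAmple` at the outer model, both ways -/

/-- **F-1401 · Def 5.3 (i) at the outer model, positive instance**: the whole group `π₁^temp(𝒢) ⋊^out Π_A` is
arithmetically ample — the augmentation onto `Π_A` is surjective, so its image `Π_A` is open (for ANY `𝒢`,
chart and outer action; the `affWitness` special case is abc-iut-w6-d099's `isArithAmple_top_outerAction`).
[cite: MochizukiSemiAnbd2006, Def 5.3 (i), p. 65] -/
theorem isArithAmple_top_outerSemidirectProduct [TopologicalSpace PA] :
    IsArithAmple (outerSemidirectProductSnd ρ) (⊤ : Subgroup (outerSemidirectProduct ρ)) :=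
  isArithAmple_top_of_surjective (outerSemidirectProductSnd_surjective ρ)

/-- **F-1401 · Def 5.3 (i) at the outer model, BOTH WAYS** (non-vacuity of the predicate at print's data,
`Π_A = π̂₁(A)` an infinite profinite group as in Ex 5.6 / [IUTchI] §2): `⊤` is arithmetically ample and
`⊥` is not (abc-iut-w4-d098 `not_isArithAmple_bot_of_compactSpace`).
[cite: MochizukiSemiAnbd2006, Def 5.3 (i), p. 65] -/
theorem isArithAmple_outerAction_both_ways [TopologicalSpace PA] [ContinuousMul PA] [CompactSpace PA]
    [Infinite PA] :
    IsArithAmple (outerSemidirectProductSnd ρ) (⊤ : Subgroup (outerSemidirectProduct ρ)) ∧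
      ¬ IsArithAmple (outerSemidirectProductSnd ρ) (⊥ : Subgroup (outerSemidirectProduct ρ)) :=
  ⟨isArithAmple_top_outerSemidirectProduct c ρ, not_isArithAmple_bot_of_compactSpace _⟩

end OuterModel

/-! ### F-1400 at the carrier of the Thm 5.4 theorem of record: the chart of the characteristic tower -/

section CharCores

variable {𝒢 : ProfiniteSemiGraph.{u}} [Finite 𝒢.graph.Vertex] [Finite 𝒢.graph.Branch]

/-- **F-1400 · Rmk 5.3.1, second sentence, AT THE CARRIER OF THE Thm 5.4 THEOREM OF RECORD** (capstone v8
`arithMaximalCompactStatement_outerAction_piPresentation_charCores_of_branchTransport`, p449794): the outer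
model `π₁^temp(𝒢) ⋊^out Π_A` for the chart of the CHARACTERISTIC Galois tower `GaloisLevelData.ofCharCores`, any
outer action `ρ'`, conclusion at an arbitrary compatible choice `Rc'` of §3 representatives — hypothesis-free
beyond Thm 3.7's frame `h37`, `hG` and the Def 5.1 (i) coherence inputs `hVt`, `hEt` of the tower.
[cite: MochizukiSemiAnbd2006, Rmk 5.3.1, p. 65] -/
theorem intersectionWithGeometricStatement_outerAction_charCores (h37 : 𝒢.Thm37Hypotheses)
    (hG : 𝒢.graph.IsGraph) (v₀ : 𝒢.graph.Vertex)
    (hVt : ∀ v : 𝒢.graph.Vertex, IsTopologicallyFinitelyGenerated (𝒢.Gv v))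
    (hEt : ∀ e : 𝒢.graph.Edge, IsTopologicallyFinitelyGenerated (𝒢.Ge e))
    {PA : Type u} [Group PA]
    (ρ' : PA →* TopOut ((GaloisLevelData.ofCharCores h37.toProp36Hypotheses v₀ hVt hEt).chart
      h37.toProp36Hypotheses.isCountable
      (ofCharCores_exists_level_splits_component h37.toProp36Hypotheses v₀ hVt hEt)
      h37.toProp36Hypotheses.isConnected (ofCharCores_splits_self h37.toProp36Hypotheses v₀ hVt hEt)
      (ofCharCores_isFinite h37.toProp36Hypotheses v₀ hVt hEt)
      (ofCharCores_hasNonemptyFibres h37.toProp36Hypotheses v₀ hVt hEt)).G)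
    (Rc' : ChartRepresentatives ((GaloisLevelData.ofCharCores h37.toProp36Hypotheses v₀ hVt hEt).chart
      h37.toProp36Hypotheses.isCountable
      (ofCharCores_exists_level_splits_component h37.toProp36Hypotheses v₀ hVt hEt)
      h37.toProp36Hypotheses.isConnected (ofCharCores_splits_self h37.toProp36Hypotheses v₀ hVt hEt)
      (ofCharCores_isFinite h37.toProp36Hypotheses v₀ hVt hEt)
      (ofCharCores_hasNonemptyFibres h37.toProp36Hypotheses v₀ hVt hEt))) :
    IntersectionWithGeometricStatement (decompositionDataOfChart Rc' (toOuterSemidirectProduct ρ'))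
      (outerSemidirectProductSnd ρ')
      (fun K => ∃ w : 𝒢.graph.Vertex, ∃ H ∈ verticialSubgroups
        ((GaloisLevelData.ofCharCores h37.toProp36Hypotheses v₀ hVt hEt).chart
          h37.toProp36Hypotheses.isCountable
          (ofCharCores_exists_level_splits_component h37.toProp36Hypotheses v₀ hVt hEt)
          h37.toProp36Hypotheses.isConnected (ofCharCores_splits_self h37.toProp36Hypotheses v₀ hVt hEt)
          (ofCharCores_isFinite h37.toProp36Hypotheses v₀ hVt hEt)
          (ofCharCores_hasNonemptyFibres h37.toProp36Hypotheses v₀ hVt hEt)) w,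
        K = H.map (toOuterSemidirectProduct ρ'))
      (fun K => ∃ e : 𝒢.graph.Edge, ∃ L ∈ edgeLikeSubgroups
        ((GaloisLevelData.ofCharCores h37.toProp36Hypotheses v₀ hVt hEt).chart
          h37.toProp36Hypotheses.isCountable
          (ofCharCores_exists_level_splits_component h37.toProp36Hypotheses v₀ hVt hEt)
          h37.toProp36Hypotheses.isConnected (ofCharCores_splits_self h37.toProp36Hypotheses v₀ hVt hEt)
          (ofCharCores_isFinite h37.toProp36Hypotheses v₀ hVt hEt)
          (ofCharCores_hasNonemptyFibres h37.toProp36Hypotheses v₀ hVt hEt)) e,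
        K = L.map (toOuterSemidirectProduct ρ')) :=
  intersectionWithGeometricStatement_outerAction_of_finiteBranch _ ρ' h37 hG Rc'

end CharCores

end ProfiniteSemiGraph

/-! ### F-0263 — Def 5.1 (i)(a) at the genuine arithmetic component `π̂₁(A) = G_K` -/

section Def51A

open Field

/-- **F-0263 · Def 5.1 (i)(a) at `π̂₁(A) := G_K`, `K` a non-archimedean local field of characteristic `0`**
(the arithmetic component of Ex 5.6): `G_K` is topologically finitely generated — modulo Tate's local
Euler–Poincaré characteristic for `K` BY NAME (the tree's named fact `localEulerPoincareCharacteristic K`,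
proved Summits-side; abc-iut-L4-d1 `isTopologicallyFinitelyGenerated_absoluteGaloisGroup_of_localEPC`).
[cite: MochizukiSemiAnbd2006, Def 5.1 (i)(a), p. 62] [cite: NeukirchSchmidtWingberg2008, Thm. 7.5.10] -/
theorem def51CondA_absoluteGaloisGrp_of_localEPC (K : Type) [Field K] [ValuativeRel K]
    [TopologicalSpace K] [IsNonarchimedeanLocalField K] [CharZero K]
    (hEP : Literature.NumberTheory.GaloisRepresentations.localEulerPoincareCharacteristic K) :
    Def51CondA (absoluteGaloisGrp K) :=
  isTopologicallyFinitelyGenerated_absoluteGaloisGroup_of_localEPC K hEP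

/-- **F-0263 · Def 5.1 (i)(a) at `π̂₁(A) := G_K`, `K/ℚ_p` finite** (the `ℚ_p`-binder form), modulo the local
Euler–Poincaré characteristic BY NAME (`isTopologicallyFinitelyGenerated_absoluteGaloisGroup_padic_of_localEPC`).
[cite: MochizukiSemiAnbd2006, Def 5.1 (i)(a), p. 62] [cite: NeukirchSchmidtWingberg2008, Thm. 7.5.10] -/
theorem def51CondA_absoluteGaloisGrp_padic_of_localEPC
    (hEP : ∀ (F : Type) [Field F] [ValuativeRel F] [TopologicalSpace F] [IsNonarchimedeanLocalField F]
      [CharZero F], Literature.NumberTheory.GaloisRepresentations.localEulerPoincareCharacteristic F)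
    (p : ℕ) [Fact p.Prime] (K : Type) [Field K] [Algebra ℚ_[p] K] [FiniteDimensional ℚ_[p] K]
    [CharZero K] : Def51CondA (absoluteGaloisGrp K) :=
  isTopologicallyFinitelyGenerated_absoluteGaloisGroup_padic_of_localEPC hEP p K

/-- **F-0263 at the genuine carrier, BOTH WAYS**: modulo the local Euler–Poincaré characteristic, Def 5.1 (i)(a)
HOLDS at `G_{ℚ_p}` (Ex 5.6's arithmetic component) and FAILS at `G_ℚ` (abc-iut-L4
`not_isTopologicallyFinitelyGenerated_absoluteGaloisGroup`, [AbsTopI] Thm 1.7 (iii)) — the condition is a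
genuine restriction on the arithmetic component. [cite: MochizukiSemiAnbd2006, Def 5.1 (i)(a), p. 62] -/
theorem def51CondA_padic_and_not_rat_of_localEPC
    (hEP : ∀ (F : Type) [Field F] [ValuativeRel F] [TopologicalSpace F] [IsNonarchimedeanLocalField F]
      [CharZero F], Literature.NumberTheory.GaloisRepresentations.localEulerPoincareCharacteristic F)
    (p : ℕ) [Fact p.Prime] :
    Def51CondA (absoluteGaloisGrp ℚ_[p]) ∧ ¬ Def51CondA (absoluteGaloisGrp ℚ) :=
  ⟨def51CondA_absoluteGaloisGrp_padic_of_localEPC hEP p ℚ_[p], not_def51CondA_absoluteGaloisGrp ℚ⟩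

end Def51A

/-! ### F-0263 / F-1411 / F-2513 — Def 5.1 (i)(a)–(d) at every connected arithmetic semi-graph of anabelioids -/

section Def51Structure

variable {Obj : Type u} [Category.{v} Obj] (𝓥 : SemiAnbdVocab.{u, v, w} Obj)

/-- **Def 5.1 (i) at the genuine carrier** (every connected arithmetic semi-graph of anabelioids
`𝔊 = (𝔾, A, ρ_𝔾)`, Def 5.1 (ii)): for SOME open subgroup `H ⊆ π̂₁(A)` the conditions (a)–(d) hold — the
continuity of `ρ_𝔾` is part of the structure. [cite: MochizukiSemiAnbd2006, Def 5.1 (ii), p. 62] -/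
theorem ArithSemiGraph.exists_isContinuousActionAt (𝔊 : ArithSemiGraph 𝓥) :
    ∃ H : OpenSubgroup 𝔊.PA, IsContinuousActionAt 𝓥 𝔊.G 𝔊.PA 𝔊.ρ H :=
  𝔊.continuous

/-- **F-0263 · Def 5.1 (i)(a) at the genuine carrier**: the arithmetic fundamental group `π̂₁(A)` of every
connected arithmetic semi-graph of anabelioids is topologically finitely generated.
[cite: MochizukiSemiAnbd2006, Def 5.1 (i)(a), p. 62] -/
theorem ArithSemiGraph.def51CondA (𝔊 : ArithSemiGraph 𝓥) : Def51CondA 𝔊.PA := by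
  obtain ⟨H, hH⟩ := 𝔊.continuous
  exact hH.condA

/-- **F-2513 · Def 5.1 (i)(c) at the genuine carrier**: for every connected arithmetic semi-graph of
anabelioids some open `H ⊆ π̂₁(A)` acts trivially on the underlying semi-graph with continuous outer
representations `H → Out(π̂₁(𝔾_v))`. [cite: MochizukiSemiAnbd2006, Def 5.1 (i)(c), p. 62] -/
theorem ArithSemiGraph.exists_def51CondC (𝔊 : ArithSemiGraph 𝓥) :
    ∃ H : OpenSubgroup 𝔊.PA, Def51CondC 𝓥 𝔊.G 𝔊.PA 𝔊.ρ H := by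
  obtain ⟨H, hH⟩ := 𝔊.continuous
  exact ⟨H, hH.condC⟩

/-- **Def 5.1 (i)(d) at the genuine carrier**: for every connected arithmetic semi-graph of anabelioids some
open `H ⊆ π̂₁(A)` fixes the vertices and admits finitely many `H`-equivariant isomorphism types of
localizations `𝔾[w]`. [cite: MochizukiSemiAnbd2006, Def 5.1 (i)(d), p. 62] -/
theorem ArithSemiGraph.exists_def51CondD (𝔊 : ArithSemiGraph 𝓥) :
    ∃ (H : OpenSubgroup 𝔊.PA) (hfix : ∀ h ∈ H, ∀ x : 𝓥.Vert 𝔊.G, 𝓥.mapV (𝔊.ρ h).hom x = x),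
      Def51CondD 𝓥 𝔊.G 𝔊.PA 𝔊.ρ H hfix := by
  obtain ⟨H, hH⟩ := 𝔊.continuous
  exact ⟨H, hH.condC.fixesVert, hH.condD⟩

/-- **F-0263 ∧ F-1411 ∧ F-2513 (∧ (d)) jointly at the genuine carrier, ONE witnessing open subgroup**: for
every connected arithmetic semi-graph of anabelioids there is an open `H ⊆ π̂₁(A)` with (a) `π̂₁(A)`
topologically finitely generated, (b) `𝔾` locally finite, (c) `H` acting trivially with continuous outer
representations, (d) finitely many `H`-equivariant localization types.
[cite: MochizukiSemiAnbd2006, Def 5.1 (i), p. 62] -/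
theorem ArithSemiGraph.exists_def51Cond_abcd (𝔊 : ArithSemiGraph 𝓥) :
    ∃ H : OpenSubgroup 𝔊.PA, Def51CondA 𝔊.PA ∧ Def51CondB 𝓥 𝔊.G ∧
      ∃ hC : Def51CondC 𝓥 𝔊.G 𝔊.PA 𝔊.ρ H, Def51CondD 𝓥 𝔊.G 𝔊.PA 𝔊.ρ H hC.fixesVert := by
  obtain ⟨H, hH⟩ := 𝔊.continuous
  exact ⟨H, hH.condA, hH.condB, hH.condC, hH.condD⟩

end Def51Structure

end Literature.AnabelianGeometry.SemiGraphs

end
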